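import Mathlib
import Summits.AtomisticToContinuum.Crystallization.Theorems.ChessboardParticlePlanesLjLaminarWindowsGlueC5
import HarnessLib

/-! # Slab-disc packing — stub `stub_slabCount` of line `Sketch` (skeleton rev. 10, lead c6), crux `LjLaminarWindows` (stmt-AtomisticToContinuum-6711) -/

noncomputable section

open scoped BigOperators
open Filter Topology
open Literature.MathematicalPhysics.StatisticalMechanics
open Summit.AtomisticToContinuum.Crystallization.Theorems.ChargedEnergyGapNegative

namespace Summit.AtomisticToContinuum.Crystallization.Theorems.LjLaminarWindowsSketch

/-- **Cell count in a box (indexed points).** If the points `v p`, `p ∈ S`, with distinct indices are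
at distance `≥ 7/10` and every coordinate satisfies `|v p j| ≤ c j`, then
`#S ≤ ∏ⱼ (2 c j / (2/5) + 1)`: the cell map `p ↦ (⌊(v p j + c j)/(2/5)⌋₊)ⱼ` is injective on `S` (two
points of one cell of side `2/5` are at distance `< 7/10`, since `3 · (2/5)² = 12/25 < 49/100`) and its
image lies in a grid of `∏ⱼ (⌊2 c j/(2/5)⌋₊ + 1)` cells. [folklore] -/
theorem slabCount_card_le_prod {N : ℕ} (v : Fin N → E3) (S : Finset (Fin N))
    (hsep : ∀ p ∈ S, ∀ q ∈ S, p ≠ q → (7 : ℝ) / 10 ≤ dist (v p) (v q))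
    (c : Fin 3 → ℝ) (hc : ∀ j, 0 ≤ c j) (hbox : ∀ p ∈ S, ∀ j, |v p j| ≤ c j) :
    (S.card : ℝ) ≤ ∏ j, (2 * c j / (2 / 5) + 1) := by
  -- adapted from `PalmGoodLaw.FunnelBoundaryCount.card_le_prod_of_separated_box`
  have hpos : (0 : ℝ) < 2 / 5 := by norm_num
  have hne : (2 : ℝ) / 5 ≠ 0 := hpos.ne'
  -- the cell map lands in the grid and is injective on `S`
  have key : S.card ≤
      (Fintype.piFinset fun j : Fin 3 => Finset.range (⌊2 * c j / (2 / 5)⌋₊ + 1)).card := by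
    refine Finset.card_le_card_of_injOn (fun p j => ⌊(v p j + c j) / (2 / 5)⌋₊) ?_ ?_
    · intro p hp
      rw [Finset.mem_coe] at hp
      rw [Finset.mem_coe, Fintype.mem_piFinset]
      intro j
      rw [Finset.mem_range]
      refine Nat.lt_succ_of_le (Nat.floor_le_floor ?_)
      exact div_le_div_of_nonneg_right (by linarith [(abs_le.1 (hbox p hp j)).2]) hpos.le
    · intro p hp q hq hpq
      rw [Finset.mem_coe] at hp hq
      by_contra hpqne
      have hsep' : (7 : ℝ) / 10 ≤ dist (v p) (v q) := hsep p hp q hq hpqne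
      -- coordinates of two points of one cell differ by `< 2/5`
      have hcoord : ∀ j, dist (v p j) (v q j) ^ 2 < (2 / 5 : ℝ) ^ 2 := by
        intro j
        have hj : ⌊(v p j + c j) / (2 / 5)⌋₊ = ⌊(v q j + c j) / (2 / 5)⌋₊ := congr_fun hpq j
        have hp0 : 0 ≤ (v p j + c j) / (2 / 5) :=
          div_nonneg (by linarith [(abs_le.1 (hbox p hp j)).1]) hpos.le
        have hq0 : 0 ≤ (v q j + c j) / (2 / 5) :=
          div_nonneg (by linarith [(abs_le.1 (hbox q hq j)).1]) hpos.le
        have hcast : (⌊(v p j + c j) / (2 / 5)⌋₊ : ℝ) = ⌊(v q j + c j) / (2 / 5)⌋₊ := by rw [hj]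
        have hpl := Nat.lt_floor_add_one ((v p j + c j) / (2 / 5))
        have hql := Nat.lt_floor_add_one ((v q j + c j) / (2 / 5))
        have hpf := Nat.floor_le hp0
        have hqf := Nat.floor_le hq0
        have h1 : (v p j + c j) / (2 / 5) - (v q j + c j) / (2 / 5) < 1 := by linarith
        have h2 : (v q j + c j) / (2 / 5) - (v p j + c j) / (2 / 5) < 1 := by linarith
        have hd : v p j - v q j = ((v p j + c j) / (2 / 5) - (v q j + c j) / (2 / 5)) * (2 / 5) := by
          rw [← sub_div, div_mul_cancel₀ _ hne]; ring
        have hsq : ((v p j + c j) / (2 / 5) - (v q j + c j) / (2 / 5)) ^ 2 < 1 := by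
          nlinarith [mul_pos
            (show (0 : ℝ) < 1 - ((v p j + c j) / (2 / 5) - (v q j + c j) / (2 / 5)) by linarith)
            (show (0 : ℝ) < 1 + ((v p j + c j) / (2 / 5) - (v q j + c j) / (2 / 5)) by linarith)]
        calc dist (v p j) (v q j) ^ 2
            = ((v p j + c j) / (2 / 5) - (v q j + c j) / (2 / 5)) ^ 2 * (2 / 5) ^ 2 := by
              rw [Real.dist_eq, sq_abs, hd]; ring
          _ < 1 * (2 / 5) ^ 2 := mul_lt_mul_of_pos_right hsq (by positivity)
          _ = (2 / 5) ^ 2 := one_mul _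
      have hlt : dist (v p) (v q) < 7 / 10 := by
        rw [EuclideanSpace.dist_eq, Real.sqrt_lt' (by norm_num : (0 : ℝ) < 7 / 10),
          Fin.sum_univ_three]
        have h0 := hcoord 0
        have h1 := hcoord 1
        have h2 := hcoord 2
        linarith
      exact absurd hsep' (not_le.mpr hlt)
  rw [Fintype.card_piFinset] at key
  simp only [Finset.card_range] at key
  calc (S.card : ℝ) ≤ ∏ j, ((⌊2 * c j / (2 / 5)⌋₊ : ℝ) + 1) := by exact_mod_cast key
    _ ≤ ∏ j, (2 * c j / (2 / 5) + 1) := by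
        apply Finset.prod_le_prod
        · intro j _
          positivity
        · intro j _
          have := Nat.floor_le (div_nonneg (by linarith [hc j]) hpos.le : 0 ≤ 2 * c j / (2 / 5))
          linarith

/-- **C6c — slab-disc packing** (provable now): a `7/10`-separated family of points lying, in the frame
of a linear isometry `A`, in the slab-disc `|(A (x − z))₂| ≤ R`, `|x − z| ≤ ρ` (`R, ρ ≥ 1`) has at
most `216 ρ² R` members (cells of side `2/5` hold at most one point each). [folklore] -/
theorem stub_slabCount :
    ∀ (N : ℕ) (x : Fin N → E3), (∀ j k : Fin N, j ≠ k → (7 : ℝ) / 10 ≤ dist (x j) (x k)) →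
      ∀ (R ρ : ℝ), 1 ≤ R → 1 ≤ ρ → ∀ (z : E3) (A : E3 →ₗᵢ[ℝ] E3) (S : Finset (Fin N)),
        (∀ p ∈ S, |(A (x p - z)) 2| ≤ R ∧ dist (x p) z ≤ ρ) →
        (S.card : ℝ) ≤ 216 * ρ ^ 2 * R := by
  intro N x hsep R ρ hR hρ z A S hS
  -- coordinates in the frame of `A`: `v p := A (x p - z)`; `A` preserves distances
  set v : Fin N → E3 := fun p => A (x p - z) with hv
  have hdist : ∀ p q : Fin N, dist (v p) (v q) = dist (x p) (x q) := by
    intro p q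
    simp only [hv, LinearIsometry.dist_map, dist_sub_right]
  have hsepv : ∀ p ∈ S, ∀ q ∈ S, p ≠ q → (7 : ℝ) / 10 ≤ dist (v p) (v q) := by
    intro p _ q _ hpq
    rw [hdist]
    exact hsep p q hpq
  -- the box: half-widths `ρ, ρ, R`
  set c : Fin 3 → ℝ := fun j => if j = 2 then R else ρ with hc
  have hc0 : ∀ j, 0 ≤ c j := by
    intro j
    simp only [hc]
    split_ifs <;> linarith
  have hbox : ∀ p ∈ S, ∀ j, |v p j| ≤ c j := by
    intro p hp j
    obtain ⟨h2, hd⟩ := hS p hp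
    have hnorm : ‖v p‖ ≤ ρ := by
      have h : ‖v p‖ = dist (x p) z := by
        simp only [hv, LinearIsometry.norm_map, dist_eq_norm]
      rw [h]
      exact hd
    have hj : |v p j| ≤ ρ := by
      have h := PiLp.norm_apply_le (v p) j
      rw [Real.norm_eq_abs] at h
      exact h.trans hnorm
    simp only [hc]
    split_ifs with hj2
    · subst hj2
      simpa only [hv] using h2
    · exact hj
  have key := slabCount_card_le_prod v S hsepv c hc0 hbox
  rw [Fin.prod_univ_three] at key
  have e0 : c 0 = ρ := by simp [hc]
  have e1 : c 1 = ρ := by simp [hc]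
  have e2 : c 2 = R := by simp [hc]
  rw [e0, e1, e2] at key
  -- `(5ρ + 1)² (5R + 1) ≤ (6ρ)² (6R) = 216 ρ² R`
  have h1 : 2 * ρ / (2 / 5) + 1 ≤ 6 * ρ := by
    have h : 2 * ρ / (2 / 5) = 5 * ρ := by ring
    rw [h]
    linarith
  have h2 : 2 * R / (2 / 5) + 1 ≤ 6 * R := by
    have h : 2 * R / (2 / 5) = 5 * R := by ring
    rw [h]
    linarith
  calc (S.card : ℝ) ≤ (2 * ρ / (2 / 5) + 1) * (2 * ρ / (2 / 5) + 1) * (2 * R / (2 / 5) + 1) := key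
    _ ≤ 6 * ρ * (6 * ρ) * (6 * R) := by gcongr
    _ = 216 * ρ ^ 2 * R := by ring

end Summit.AtomisticToContinuum.Crystallization.Theorems.LjLaminarWindowsSketch

end
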